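import Summits.HodgeConjecture.CorCM.MultiFieldWeilUnitsMenuFree
import Summits.HodgeConjecture.CorCM.MultiFieldWeilUnitShapes
import HarnessLib

/-!
# MULTI-FIELD WEIL ENGINE — THE UNITS MENU BY SHAPES WITH NO HYPOTHESIS BETWEEN FIELDS OF DIFFERENT DEGREES: finitely many CM fields `K_j ∋ k`, over each a list of
# pairwise non-isogenous structures of the menu (≤ 2 per sextic field, ≤ 3 per `𝔄₄`/`𝔖₄`-octic field with separation, ≤ 4 per decic field with (H1)–(H2)), `Hom = ∅`
# between fields OF THE SAME DEGREE only — the Hodge conjecture for every product of copies, given only Markman's fourfold and hyperbolic-sixfold theorems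

Cell `pub-hodgecm2` (COR-CM), seat b30 gen 41 (2026-08-26); count-neutral own lane MULTI-FIELD WEIL ENGINE (stem `MultiFieldWeil*`), the grouped (U7) and shape (G3) forms
of D3 (`CorCM/MultiFieldWeilUnitsMenuFree.lean`, `hodgeConjectureFor_biproduct_comp_of_unitsMenu_free`): the hypothesis `hout43` of U7
(`CorCM/MultiFieldWeilUnitsMenuGrouped.lean`) and G3 (`CorCM/MultiFieldWeilUnitsMenuShapes.lean`) — «for every octic field and every sextic field a `τ`-embedding of the
sextic field with a value outside the Galois closure of the octic field» — is REMOVED by the cross-degree decoupling of D1/D2 (`CorCM/MultiFieldWeilDecoupling.lean`,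
`CorCM/MultiFieldWeilRankedTransfer.lean`): the `𝔄₄`/`𝔖₄`-octic unit is `2`-transitive with more `τ`-embeddings than a sextic slot, so their signed equations decouple
with no mover (orthogonality of matrix coefficients of non-isomorphic irreducible constituents).  The statements are otherwise U7's and G3's VERBATIM.  Theorems only;
no definition, no named fact, no `sorry`.  HONEST FRAMING: conditional ONLY on the two displayed Markman binders; `HC_CM` is NOT proved and not asserted.

**`hodgeConjectureFor_biproduct_sigma_free_of_shapes`.**  `k` imaginary quadratic with `τ`, `E ⊨ (k; {τ})`; `J` finite; CM fields `KJ j ⊇ iK j (k)` of degree `2·nJ j`;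
structures `B j t ⊨ (KJ j; Ψ j t)`, `t : Fin (c j)`, with `(nJ j, p_{j,t}) ∈ {(3,1), (4,1), (4,2), (5,2)}` (types NORMALISED); sextic `B j t` SIMPLE; `B j t ≁ B j t'` for
`t ≠ t'`.  SHAPES: `c j ≤ 2` (sextic), `c j ≤ 3` (octic; every `(2,2)`-type containing the `τ`-member of exactly one of any two `(1,3)`-types), `c j ≤ 4` (decic; for
`c j = 4` (H1) every type shares a `τ`-embedding with another and (H2) some `τ`-embedding lies in `1`, `3` or `4` of them).  ARITHMETIC: octic fields with a degree-`24`
pair; decic fields with `c j ≥ 2` with a degree-`40` pair; `Hom(KJ j', KJ j) = ∅` for `j ≠ j'` OF EQUAL DEGREE — and NOTHING between fields of different degrees.  THEN the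
Hodge conjecture holds for `⨁_l X_l`, every `X_l ∈ {E} ∪ {B j t}` (any multiplicities), and for everything dominated by such a product, GIVEN ONLY Markman's two theorems.
NEWLY COVERED (example): `k = ℚ(i)`, `F₄` a totally real `𝔖₄`-quartic field and `F₃` ITS CUBIC RESOLVENT FIELD; `B ⊨ (F₄(i); (1,3))` a simple CM fourfold and `T ⊨ (F₃(i);
(1,2))` a simple CM threefold: HC for every `E^a × T^b × B^c` mod Markman 4 + 6 (G3 excluded exactly this pair).
[cite: Markman2025SurveySecant, Thm. 1.2] [cite: Markman2025SecantWeil, Thm 1.5.1] [cite: Shimura1998, §6.1 Corollary of Theorem 2, §8.2 Prop. 26, §8.4, §18.2 Lemma (i)]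
[cite: Serre1977, §2.2 Cor. 2–3 of Prop. 4; §2.3 Ex. 2.6] [cite: Deligne1982HodgeCycles, §5 (b)] [cite: Lang2002, VI §1 Thm. 1.14 and V §2 Thm. 2.8; XIII §4; XV §1]
[cite: MoonenZarhin1995Duke, Thm. 2.4] [cite: Pohlmann1968, Thm 1] [cite: DixonMortimer1996, §1.4 Ex. 1.4.1–1.4.2; §1.6, Thm. 1.6A; §2.1; §3.3, Thm. 3.3A]
[cite: Dodson1984, §1.1 Imprimitivity Theorem and §5.1.2 Theorem] [cite: MumfordAV1970, §19]

## References
* [Markman2025SurveySecant] E. Markman, arXiv:2509.23403, Thm. 1.2.  [Markman2025SecantWeil] E. Markman, Cycles on abelian 2n-folds of Weil type from secant sheaves on abelian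
  n-folds, Thm 1.5.1.  [Shimura1998] G. Shimura, *Abelian varieties with complex multiplication and modular functions*, §6.1, §8.2, §8.4, §18.2.  [Serre1977] J.-P. Serre,
  *Linear Representations of Finite Groups*, GTM 42, §2.2–§2.3.  [Deligne1982HodgeCycles] P. Deligne, LNM 900, §5 (b).  [Lang2002] S. Lang, *Algebra*, GTM 211, V §2, VI §1,
  XIII §4, XV §1.  [MoonenZarhin1995Duke] B. Moonen, Yu. Zarhin, Duke Math. J. 77 (1995), Thm. 2.4.  [Pohlmann1968] H. Pohlmann, Ann. of Math. 88 (1968), Thm 1.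
  [DixonMortimer1996] J. D. Dixon, B. Mortimer, *Permutation Groups*, GTM 163.  [Dodson1984] B. Dodson, Trans. AMS 283 (1984).  [MumfordAV1970] D. Mumford, *Abelian
  Varieties*, §19.
-/

noncomputable section

open CategoryTheory CategoryTheory.Limits NumberField IntermediateField

namespace Summit.HodgeConjecture.CorCM.MultiFieldWeil

open Finset
open Literature.AlgebraicGeometry Literature.AlgebraicGeometry.Motives Literature.AlgebraicGeometry.HodgeTheory
open Literature.AlgebraicGeometry.ComplexMultiplication (IsCMTypeRealisation)
open Literature.AlgebraicTopology.SingularHomology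
open Literature.NumberTheory.ComplexMultiplication

open scoped Classical

/-! ## §1 The independence criterion grouped by field -/

section Grouped

variable {J : Type} [Fintype J] {KJ : J → Type} [fK : ∀ j, Field (KJ j)] [nK : ∀ j, NumberField (KJ j)] [cK : ∀ j, IsCMField (KJ j)]
  {k : Type} [fk : Field k] [nk : NumberField k] [ck : IsCMField k] {τ : k →+* ℂ} {c : J → ℕ}
  {B : ∀ j : J, Fin (c j) → AbelianVariety ℂ} {Ψ : ∀ j : J, Fin (c j) → CMType (KJ j)}
  {ιB : ∀ (j : J) (t : Fin (c j)), 𝓞 (KJ j) →+* End (B j t)} {θB : ∀ (j : J) (t : Fin (c j)), KJ j →+* Module.End ℂ (complexBetti (B j t).X 1)}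
  {E : AbelianVariety ℂ} {Φ₀ : CMType k} {ιE : 𝓞 k →+* End E} {θE : k →+* Module.End ℂ (complexBetti E.X 1)}

/-- **THE INDEPENDENCE CRITERION, GROUPED BY FIELD, WITH NO HYPOTHESIS BETWEEN FIELDS OF DIFFERENT DEGREES — GIVEN ONLY MARKMAN'S FOURFOLD AND HYPERBOLIC-SIXFOLD
THEOREMS.**  U7 (`hodgeConjectureFor_biproduct_sigma_of_linearIndependent`) WITHOUT `hout43`.  See the module docstring.  `HC_CM` is NOT asserted.
[cite: Markman2025SurveySecant, Thm. 1.2] [cite: Markman2025SecantWeil, Thm 1.5.1] [cite: Shimura1998, §6.1 Corollary of Theorem 2, §8.2 Prop. 26, §18.2]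
[cite: Serre1977, §2.2 Cor. 2–3 of Prop. 4; §2.3 Ex. 2.6] [cite: Deligne1982HodgeCycles, §5 (b)] [cite: DixonMortimer1996, §1.4 Ex. 1.4.1–1.4.2; §1.6, Thm. 1.6A; §2.1]
[cite: Dodson1984, §1.1 Imprimitivity Theorem and §5.1.2 Theorem] [cite: Lang2002, XIII §4] -/
theorem hodgeConjectureFor_biproduct_sigma_free_of_linearIndependent (hW4 : Markman2025_weilClasses_algebraic_abelianFourfold)
    (hM6 : Markman2025_weilClasses_algebraic_hyperbolicSixfold) (h2 : Module.finrank ℚ k = 2) (iK : ∀ j : J, k →+* KJ j) (nJ : J → ℕ)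
    (hdeg : ∀ j, Module.finrank ℚ (KJ j) = 2 * nJ j) (hB : ∀ j t, IsCMTypeRealisation (Ψ j t) (B j t) (ιB j t) (θB j t))
    (hE : IsCMTypeRealisation Φ₀ E ιE θE) (hΦ₀ : ∀ σ : k →+* ℂ, σ ∈ Φ₀.1 ↔ σ = τ)
    (hS : ∀ j, nJ j = 3 → ∀ t, (B j t).IsSimple)
    (hcnt : ∀ j t, (nJ j = 3 ∧ (Finset.univ.filter fun s : KJ j →+* ℂ => s.comp (iK j) = τ ∧ s ∈ (Ψ j t).1).card = 1) ∨
      (nJ j = 4 ∧ (Finset.univ.filter fun s : KJ j →+* ℂ => s.comp (iK j) = τ ∧ s ∈ (Ψ j t).1).card = 1) ∨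
      (nJ j = 4 ∧ (Finset.univ.filter fun s : KJ j →+* ℂ => s.comp (iK j) = τ ∧ s ∈ (Ψ j t).1).card = 2) ∨
      (nJ j = 5 ∧ (Finset.univ.filter fun s : KJ j →+* ℂ => s.comp (iK j) = τ ∧ s ∈ (Ψ j t).1).card = 2))
    (hni : ∀ j t t', t ≠ t' → ¬ AbelianVariety.IsIsogenous (B j t) (B j t'))
    (hli : ∀ j, 2 < c j → LinearIndependent ℚ fun t : Fin (c j) => fun s : {s : KJ j →+* ℂ // s.comp (iK j) = τ} =>
      ((nJ j : ℚ) * (if s.1 ∈ (Ψ j t).1 then 1 else 0) - ((Finset.univ.filter fun u : KJ j →+* ℂ => u.comp (iK j) = τ ∧ u ∈ (Ψ j t).1).card : ℚ)))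
    (h24 : ∀ j, nJ j = 4 → ∃ s₀ t₀ : KJ j →+* ℂ, s₀.comp (iK j) = τ ∧ t₀.comp (iK j) = τ ∧ s₀ ≠ t₀ ∧
      Module.finrank ℚ ↥(adjoin ℚ (Set.range τ) ⊔ adjoin ℚ (Set.range s₀ ∪ Set.range t₀)) = 24)
    (h40 : ∀ j, nJ j = 5 → 1 < c j → ∃ s₀ t₀ : KJ j →+* ℂ, s₀.comp (iK j) = τ ∧ t₀.comp (iK j) = τ ∧ s₀ ≠ t₀ ∧
      Module.finrank ℚ ↥(adjoin ℚ (Set.range τ) ⊔ adjoin ℚ (Set.range s₀ ∪ Set.range t₀)) = 40)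
    (hiso : ∀ j j' : J, j' ≠ j → nJ j = nJ j' → IsEmpty (KJ j' →+* KJ j))
    {N : ℕ} (κ : Fin N → Option ((j : J) × Fin (c j))) :
    HodgeConjectureFor (⨁ fun l => ((κ l).elim E fun x => B x.1 x.2 : AbelianVariety ℂ)).dim (⨁ fun l => ((κ l).elim E fun x => B x.1 x.2 : AbelianVariety ℂ)).X := by
  -- enumerate the structures
  let S : Type := (j : J) × Fin (c j)
  let σ : Fin (Fintype.card S) ≃ S := (Fintype.equivFin S).symm
  -- the fields `Option.elim · k KJ` with their instances (F2's pattern)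
  let Kf : Option J → Type := fun o => o.elim k KJ
  letI instF : ∀ o, Field (Kf o) := fun o => @Option.rec J (fun o => Field (Option.elim o k KJ)) fk (fun j => fK j) o
  letI instN : ∀ o, NumberField (Kf o) := fun o => @Option.rec J (fun o => NumberField (Option.elim o k KJ)) nk (fun j => nK j) o
  haveI instC : ∀ o, IsCMField (Kf o) := fun o => @Option.rec J (fun o => IsCMField (Option.elim o k KJ)) ck (fun j => cK j) o
  let is : Fin (Fintype.card S) → Option J := fun m => some (σ m).1
  let iK' : ∀ o : Option J, Kf none →+* Kf o := fun o => @Option.rec J (fun o => k →+* Option.elim o k KJ) (RingHom.id k) (fun j => iK j) o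
  let nI : Option J → ℕ := fun o => o.elim 0 nJ
  obtain ⟨Φ', ι', θ', hA', h0, hQ⟩ := exists_realisations_cons_of (Kf := Kf) (i₀ := none) (is := is) (T := fun m => B (σ m).1 (σ m).2)
    (ΦT := fun m => Ψ (σ m).1 (σ m).2) (ιT := fun m => ιB (σ m).1 (σ m).2) (θT := fun m => θB (σ m).1 (σ m).2) (Ψ := Φ₀) (E := E) (ιE := ιE) (θE := θE) hE
    (fun m => hB (σ m).1 (σ m).2) (fun m Φ'' => Φ'' = Ψ (σ m).1 (σ m).2) (fun m => rfl)
  have hΨ' : ∀ s : Kf none →+* ℂ, s ∈ (Φ' 0).1 ↔ s = τ := by rw [h0]; exact hΦ₀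
  -- two structures over one field, transported along the enumeration
  have hniS : ∀ x y : S, x ≠ y → y.1 = x.1 → ¬ AbelianVariety.IsIsogenous (B x.1 x.2) (B y.1 y.2) := by
    rintro ⟨j, t⟩ ⟨j', t'⟩ hne h
    dsimp only at h
    subst h
    exact hni _ t t' fun htt => hne (by rw [htt])
  have heqS : ∀ (x : S) (j₀ : J) (h : x.1 = j₀) (X : CMType (KJ j₀)), HEq X (Ψ x.1 x.2) → X = Ψ j₀ (Fin.cast (congrArg c h) x.2) := by
    rintro ⟨j, t⟩ j₀ h X hX
    dsimp only at h
    subst h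
    rw [(Fin.ext rfl : Fin.cast _ t = t)]
    exact eq_of_heq hX
  -- the fibre of a slot maps injectively into `Fin (c j)`
  have hfib : ∀ m₀ : Fin (Fintype.card S), ∃ f : {m // is m = is m₀} → Fin (c (σ m₀).1), Function.Injective f ∧
      ∀ m, f m = Fin.cast (congrArg c (Option.some.inj m.2)) (σ m.1).2 := by
    intro m₀
    refine ⟨fun m => Fin.cast (congrArg c (Option.some.inj m.2)) (σ m.1).2, fun m m' hmm => ?_, fun m => rfl⟩
    have h1 : (σ m.1).1 = (σ m'.1).1 := (Option.some.inj m.2).trans (Option.some.inj m'.2).symm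
    have h2 : HEq (σ m.1).2 (σ m'.1).2 := (Fin.heq_ext_iff (congrArg c h1)).2 (by simpa only [Fin.val_cast] using congrArg Fin.val hmm)
    exact Subtype.ext (σ.injective (Sigma.ext h1 h2))
  -- D3 (U6 without `hout43`) for the enumerated family
  have key : HodgeConjectureFor
      (⨁ fun l => (Fin.cons E (fun m => B (σ m).1 (σ m).2) : Fin (Fintype.card S + 1) → AbelianVariety ℂ) ((κ l).elim 0 fun x => (σ.symm x).succ)).dim
      (⨁ fun l => (Fin.cons E (fun m => B (σ m).1 (σ m).2) : Fin (Fintype.card S + 1) → AbelianVariety ℂ) ((κ l).elim 0 fun x => (σ.symm x).succ)).X :=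
    hodgeConjectureFor_biproduct_comp_of_unitsMenu_free (Kf := Kf) (i₀ := none) (is := is) hW4 hM6
    (fun l => (κ l).elim 0 fun x => (σ.symm x).succ) h2 nI (fun m => hdeg (σ m).1) iK' hA' hΨ'
    (fun m h => by rw [Fin.cons_succ]; exact hS _ h _)
    (fun m => by rw [hQ m]; exact hcnt (σ m).1 (σ m).2)
    (fun m m' hne h => by
      rw [Fin.cons_succ, Fin.cons_succ]
      exact hniS (σ m) (σ m') (fun hs => hne (σ.injective hs).symm) (Option.some.inj h))
    (fun m₀ ⟨m₁, m₂, h12, h10, h20, hi1, hi2⟩ Ψ'' hΨ'' => by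
      obtain ⟨f, hf, hfeq⟩ := hfib m₀
      have hc : 2 < c (σ m₀).1 := by
        have h3 : ({f ⟨m₀, rfl⟩, f ⟨m₁, hi1⟩, f ⟨m₂, hi2⟩} : Finset (Fin (c (σ m₀).1))).card = 3 :=
          Finset.card_eq_three.2 ⟨_, _, _, fun h => h10 (congrArg Subtype.val (hf h)).symm, fun h => h20 (congrArg Subtype.val (hf h)).symm,
            fun h => h12 (congrArg Subtype.val (hf h)), rfl⟩
        have := Finset.card_le_univ ({f ⟨m₀, rfl⟩, f ⟨m₁, hi1⟩, f ⟨m₂, hi2⟩} : Finset (Fin (c (σ m₀).1)))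
        rw [h3, Fintype.card_fin] at this
        omega
      have hΨeq : ∀ m, Ψ'' m = Ψ (σ m₀).1 (f m) := fun m => by
        rw [hfeq m]
        exact heqS (σ m.1) (σ m₀).1 (Option.some.inj m.2) (Ψ'' m) ((hΨ'' m).trans (heq_of_eq (hQ m.1)))
      have hfun : (fun m : {m // is m = is m₀} => fun s : {s : Kf (is m₀) →+* ℂ // s.comp (iK' (is m₀)) = τ} =>
          ((nI (is m₀) : ℚ) * (if s.1 ∈ (Ψ'' m).1 then 1 else 0) -
            ((Finset.univ.filter fun u : Kf (is m₀) →+* ℂ => u.comp (iK' (is m₀)) = τ ∧ u ∈ (Ψ'' m).1).card : ℚ))) =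
          (fun t : Fin (c (σ m₀).1) => fun s : {s : KJ (σ m₀).1 →+* ℂ // s.comp (iK (σ m₀).1) = τ} =>
            ((nJ (σ m₀).1 : ℚ) * (if s.1 ∈ (Ψ (σ m₀).1 t).1 then 1 else 0) -
              ((Finset.univ.filter fun u : KJ (σ m₀).1 →+* ℂ => u.comp (iK (σ m₀).1) = τ ∧ u ∈ (Ψ (σ m₀).1 t).1).card : ℚ))) ∘ f := by
        funext m; rw [Function.comp_apply, hΨeq m]; rfl
      rw [hfun]
      exact (hli (σ m₀).1 hc).comp f hf)
    (fun m h4 => h24 (σ m).1 h4) (fun m h5 ⟨m', hne, heq⟩ => by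
      obtain ⟨f, hf, -⟩ := hfib m
      refine h40 (σ m).1 h5 ?_
      have h2c : ({f ⟨m, rfl⟩, f ⟨m', heq⟩} : Finset (Fin (c (σ m).1))).card = 2 := Finset.card_pair fun h => hne (congrArg Subtype.val (hf h)).symm
      have := Finset.card_le_univ ({f ⟨m, rfl⟩, f ⟨m', heq⟩} : Finset (Fin (c (σ m).1)))
      rw [h2c, Fintype.card_fin] at this
      omega)
    (fun m₀ m hne hn => hiso (σ m₀).1 (σ m).1 (fun h => hne (congrArg some h)) hn)
  -- the two families of factors agree
  have hfam : (fun l => (Fin.cons E (fun m => B (σ m).1 (σ m).2) : Fin (Fintype.card S + 1) → AbelianVariety ℂ) ((κ l).elim 0 fun x => (σ.symm x).succ)) =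
      fun l => ((κ l).elim E fun x => B x.1 x.2 : AbelianVariety ℂ) := by
    funext l
    rcases hκ : κ l with _ | x
    · rfl
    · show (Fin.cons E (fun m => B (σ m).1 (σ m).2) : Fin (Fintype.card S + 1) → AbelianVariety ℂ) (σ.symm x).succ = B x.1 x.2
      rw [Fin.cons_succ]
      exact congrArg (fun y : S => B y.1 y.2) (σ.apply_symm_apply x)
  rw [hfam] at key
  exact key

end Grouped

/-! ## §2 The units menu by shapes -/

section Shapes

variable {J : Type} [Fintype J] {KJ : J → Type} [fK : ∀ j, Field (KJ j)] [nK : ∀ j, NumberField (KJ j)] [cK : ∀ j, IsCMField (KJ j)]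
  {k : Type} [fk : Field k] [nk : NumberField k] [ck : IsCMField k] {τ : k →+* ℂ} {c : J → ℕ}
  {B : ∀ j : J, Fin (c j) → AbelianVariety ℂ} {Ψ : ∀ j : J, Fin (c j) → CMType (KJ j)}
  {ιB : ∀ (j : J) (t : Fin (c j)), 𝓞 (KJ j) →+* End (B j t)} {θB : ∀ (j : J) (t : Fin (c j)), KJ j →+* Module.End ℂ (complexBetti (B j t).X 1)}
  {E : AbelianVariety ℂ} {Φ₀ : CMType k} {ιE : 𝓞 k →+* End E} {θE : k →+* Module.End ℂ (complexBetti E.X 1)}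

/-- **THE UNITS MENU BY SHAPES WITH NO HYPOTHESIS BETWEEN FIELDS OF DIFFERENT DEGREES — GIVEN ONLY MARKMAN'S FOURFOLD AND HYPERBOLIC-SIXFOLD THEOREMS.**  G3
(`hodgeConjectureFor_biproduct_sigma_of_shapes`) WITHOUT `hout43`.  See the module docstring.  `HC_CM` is NOT asserted. [cite: Markman2025SurveySecant, Thm. 1.2]
[cite: Markman2025SecantWeil, Thm 1.5.1] [cite: Shimura1998, §6.1 Corollary of Theorem 2, §8.2 Prop. 26, §18.2] [cite: Serre1977, §2.2 Cor. 2–3 of Prop. 4; §2.3 Ex. 2.6]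
[cite: Deligne1982HodgeCycles, §5 (b)] [cite: DixonMortimer1996, §1.4 Ex. 1.4.1–1.4.2; §1.6, Thm. 1.6A; §2.1] [cite: Dodson1984, §1.1 Imprimitivity Theorem and §5.1.2 Theorem]
[cite: Lang2002, XIII §4; XV §1] -/
theorem hodgeConjectureFor_biproduct_sigma_free_of_shapes (hW4 : Markman2025_weilClasses_algebraic_abelianFourfold)
    (hM6 : Markman2025_weilClasses_algebraic_hyperbolicSixfold) (h2 : Module.finrank ℚ k = 2) (iK : ∀ j : J, k →+* KJ j) (nJ : J → ℕ)
    (hdeg : ∀ j, Module.finrank ℚ (KJ j) = 2 * nJ j) (hB : ∀ j t, IsCMTypeRealisation (Ψ j t) (B j t) (ιB j t) (θB j t))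
    (hE : IsCMTypeRealisation Φ₀ E ιE θE) (hΦ₀ : ∀ σ : k →+* ℂ, σ ∈ Φ₀.1 ↔ σ = τ)
    (hS : ∀ j, nJ j = 3 → ∀ t, (B j t).IsSimple)
    (hcnt : ∀ j t, (nJ j = 3 ∧ (Finset.univ.filter fun s : KJ j →+* ℂ => s.comp (iK j) = τ ∧ s ∈ (Ψ j t).1).card = 1) ∨
      (nJ j = 4 ∧ (Finset.univ.filter fun s : KJ j →+* ℂ => s.comp (iK j) = τ ∧ s ∈ (Ψ j t).1).card = 1) ∨
      (nJ j = 4 ∧ (Finset.univ.filter fun s : KJ j →+* ℂ => s.comp (iK j) = τ ∧ s ∈ (Ψ j t).1).card = 2) ∨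
      (nJ j = 5 ∧ (Finset.univ.filter fun s : KJ j →+* ℂ => s.comp (iK j) = τ ∧ s ∈ (Ψ j t).1).card = 2))
    (hni : ∀ j t t', t ≠ t' → ¬ AbelianVariety.IsIsogenous (B j t) (B j t'))
    (hc3 : ∀ j, nJ j = 3 → c j ≤ 2) (hc4 : ∀ j, nJ j = 4 → c j ≤ 3) (hc5 : ∀ j, nJ j = 5 → c j ≤ 4)
    (hsep : ∀ j, nJ j = 4 → ∀ t₁ t₂ t₃ : Fin (c j), t₁ ≠ t₂ → (Finset.univ.filter fun u : KJ j →+* ℂ => u.comp (iK j) = τ ∧ u ∈ (Ψ j t₁).1).card = 1 →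
      (Finset.univ.filter fun u : KJ j →+* ℂ => u.comp (iK j) = τ ∧ u ∈ (Ψ j t₂).1).card = 1 →
      (Finset.univ.filter fun u : KJ j →+* ℂ => u.comp (iK j) = τ ∧ u ∈ (Ψ j t₃).1).card = 2 →
      ∀ s₁ s₂ : KJ j →+* ℂ, s₁.comp (iK j) = τ → s₂.comp (iK j) = τ → s₁ ∈ (Ψ j t₁).1 → s₂ ∈ (Ψ j t₂).1 → (s₁ ∈ (Ψ j t₃).1 ↔ s₂ ∉ (Ψ j t₃).1))
    (hmeet : ∀ j, nJ j = 5 → c j = 4 → ∀ t : Fin (c j), ∃ t', t' ≠ t ∧ ∃ s : KJ j →+* ℂ, s.comp (iK j) = τ ∧ s ∈ (Ψ j t).1 ∧ s ∈ (Ψ j t').1)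
    (hodd : ∀ j, nJ j = 5 → c j = 4 → ∃ s : KJ j →+* ℂ, s.comp (iK j) = τ ∧ (Finset.univ.filter fun t : Fin (c j) => s ∈ (Ψ j t).1).card ≠ 0 ∧
      (Finset.univ.filter fun t : Fin (c j) => s ∈ (Ψ j t).1).card ≠ 2)
    (h24 : ∀ j, nJ j = 4 → ∃ s₀ t₀ : KJ j →+* ℂ, s₀.comp (iK j) = τ ∧ t₀.comp (iK j) = τ ∧ s₀ ≠ t₀ ∧
      Module.finrank ℚ ↥(adjoin ℚ (Set.range τ) ⊔ adjoin ℚ (Set.range s₀ ∪ Set.range t₀)) = 24)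
    (h40 : ∀ j, nJ j = 5 → 1 < c j → ∃ s₀ t₀ : KJ j →+* ℂ, s₀.comp (iK j) = τ ∧ t₀.comp (iK j) = τ ∧ s₀ ≠ t₀ ∧
      Module.finrank ℚ ↥(adjoin ℚ (Set.range τ) ⊔ adjoin ℚ (Set.range s₀ ∪ Set.range t₀)) = 40)
    (hiso : ∀ j j' : J, j' ≠ j → nJ j = nJ j' → IsEmpty (KJ j' →+* KJ j))
    {N : ℕ} (κ : Fin N → Option ((j : J) × Fin (c j))) :
    HodgeConjectureFor (⨁ fun l => ((κ l).elim E fun x => B x.1 x.2 : AbelianVariety ℂ)).dim (⨁ fun l => ((κ l).elim E fun x => B x.1 x.2 : AbelianVariety ℂ)).X := by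
  -- distinct and non-conjugate types from non-isogeny (Shimura's criterion)
  have hne : ∀ j (t t' : Fin (c j)), t ≠ t' → (Ψ j t).1 ≠ (Ψ j t').1 ∧ (Ψ j t').1 ≠ (Ψ j t).1ᶜ := fun j t t' htt =>
    DihedralSexticPair.cmType_ne_and_ne_compl_of_not_isIsogenous (hB j t) (hB j t') (hni j t t' htt)
  refine hodgeConjectureFor_biproduct_sigma_free_of_linearIndependent hW4 hM6 h2 iK nJ hdeg hB hE hΦ₀ hS hcnt hni (fun j hcj => ?_) h24 h40 hiso κ
  -- the independence hypothesis of U7 for a field with three or more structures, by shape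
  have hcard : Fintype.card (Fin (c j)) = c j := Fintype.card_fin _
  obtain ⟨t₀⟩ : Nonempty (Fin (c j)) := ⟨⟨0, by omega⟩⟩
  rcases hcnt j t₀ with ⟨h3, -⟩ | ⟨h4, -⟩ | ⟨h4, -⟩ | ⟨h5, -⟩
  · have := hc3 j h3; omega
  · have hc : c j = 3 := by have := hc4 j h4; omega
    exact linearIndependent_typeCells_of_three_octic h2 (iK j) (hdeg j) h4 τ (by rw [hcard, hc]) (Ψ j)
      (fun t => by rcases hcnt j t with ⟨h, -⟩ | ⟨-, h⟩ | ⟨-, h⟩ | ⟨h, -⟩ <;> omega) (hne j) (hsep j h4)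
  · have hc : c j = 3 := by have := hc4 j h4; omega
    exact linearIndependent_typeCells_of_three_octic h2 (iK j) (hdeg j) h4 τ (by rw [hcard, hc]) (Ψ j)
      (fun t => by rcases hcnt j t with ⟨h, -⟩ | ⟨-, h⟩ | ⟨-, h⟩ | ⟨h, -⟩ <;> omega) (hne j) (hsep j h4)
  · have hcnt5 : ∀ t : Fin (c j), (Finset.univ.filter fun u : KJ j →+* ℂ => u.comp (iK j) = τ ∧ u ∈ (Ψ j t).1).card = 2 := fun t => by
      rcases hcnt j t with ⟨h, -⟩ | ⟨h, -⟩ | ⟨h, -⟩ | ⟨-, h⟩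
      · omega
      · omega
      · omega
      · exact h
    by_cases hc : c j = 3
    · exact linearIndependent_typeCells_of_three_pairs h2 (iK j) (hdeg j) h5 τ (by rw [hcard, hc]) (Ψ j) hcnt5 fun t t' htt => (hne j t t' htt).1
    · have hc' : c j = 4 := by have := hc5 j h5; omega
      exact linearIndependent_typeCells_of_four_pairs h2 (iK j) (hdeg j) h5 τ (by rw [hcard, hc']) (Ψ j) hcnt5 (fun t t' htt => (hne j t t' htt).1)
        (hmeet j h5 hc') (hodd j h5 hc')

/-- **Dominated form**: every complex abelian variety dominated by such a product of copies (an isogeny factor, `s ≫ π = [N]`). [cite: Markman2025SurveySecant, Thm. 1.2]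
[cite: Markman2025SecantWeil, Thm 1.5.1] [cite: MumfordAV1970, §19] -/
theorem hodgeConjectureFor_of_avDominatedBy_sigma_free_of_shapes (hW4 : Markman2025_weilClasses_algebraic_abelianFourfold)
    (hM6 : Markman2025_weilClasses_algebraic_hyperbolicSixfold) (h2 : Module.finrank ℚ k = 2) (iK : ∀ j : J, k →+* KJ j) (nJ : J → ℕ)
    (hdeg : ∀ j, Module.finrank ℚ (KJ j) = 2 * nJ j) (hB : ∀ j t, IsCMTypeRealisation (Ψ j t) (B j t) (ιB j t) (θB j t))
    (hE : IsCMTypeRealisation Φ₀ E ιE θE) (hΦ₀ : ∀ σ : k →+* ℂ, σ ∈ Φ₀.1 ↔ σ = τ)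
    (hS : ∀ j, nJ j = 3 → ∀ t, (B j t).IsSimple)
    (hcnt : ∀ j t, (nJ j = 3 ∧ (Finset.univ.filter fun s : KJ j →+* ℂ => s.comp (iK j) = τ ∧ s ∈ (Ψ j t).1).card = 1) ∨
      (nJ j = 4 ∧ (Finset.univ.filter fun s : KJ j →+* ℂ => s.comp (iK j) = τ ∧ s ∈ (Ψ j t).1).card = 1) ∨
      (nJ j = 4 ∧ (Finset.univ.filter fun s : KJ j →+* ℂ => s.comp (iK j) = τ ∧ s ∈ (Ψ j t).1).card = 2) ∨
      (nJ j = 5 ∧ (Finset.univ.filter fun s : KJ j →+* ℂ => s.comp (iK j) = τ ∧ s ∈ (Ψ j t).1).card = 2))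
    (hni : ∀ j t t', t ≠ t' → ¬ AbelianVariety.IsIsogenous (B j t) (B j t'))
    (hc3 : ∀ j, nJ j = 3 → c j ≤ 2) (hc4 : ∀ j, nJ j = 4 → c j ≤ 3) (hc5 : ∀ j, nJ j = 5 → c j ≤ 4)
    (hsep : ∀ j, nJ j = 4 → ∀ t₁ t₂ t₃ : Fin (c j), t₁ ≠ t₂ → (Finset.univ.filter fun u : KJ j →+* ℂ => u.comp (iK j) = τ ∧ u ∈ (Ψ j t₁).1).card = 1 →
      (Finset.univ.filter fun u : KJ j →+* ℂ => u.comp (iK j) = τ ∧ u ∈ (Ψ j t₂).1).card = 1 →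
      (Finset.univ.filter fun u : KJ j →+* ℂ => u.comp (iK j) = τ ∧ u ∈ (Ψ j t₃).1).card = 2 →
      ∀ s₁ s₂ : KJ j →+* ℂ, s₁.comp (iK j) = τ → s₂.comp (iK j) = τ → s₁ ∈ (Ψ j t₁).1 → s₂ ∈ (Ψ j t₂).1 → (s₁ ∈ (Ψ j t₃).1 ↔ s₂ ∉ (Ψ j t₃).1))
    (hmeet : ∀ j, nJ j = 5 → c j = 4 → ∀ t : Fin (c j), ∃ t', t' ≠ t ∧ ∃ s : KJ j →+* ℂ, s.comp (iK j) = τ ∧ s ∈ (Ψ j t).1 ∧ s ∈ (Ψ j t').1)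
    (hodd : ∀ j, nJ j = 5 → c j = 4 → ∃ s : KJ j →+* ℂ, s.comp (iK j) = τ ∧ (Finset.univ.filter fun t : Fin (c j) => s ∈ (Ψ j t).1).card ≠ 0 ∧
      (Finset.univ.filter fun t : Fin (c j) => s ∈ (Ψ j t).1).card ≠ 2)
    (h24 : ∀ j, nJ j = 4 → ∃ s₀ t₀ : KJ j →+* ℂ, s₀.comp (iK j) = τ ∧ t₀.comp (iK j) = τ ∧ s₀ ≠ t₀ ∧
      Module.finrank ℚ ↥(adjoin ℚ (Set.range τ) ⊔ adjoin ℚ (Set.range s₀ ∪ Set.range t₀)) = 24)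
    (h40 : ∀ j, nJ j = 5 → 1 < c j → ∃ s₀ t₀ : KJ j →+* ℂ, s₀.comp (iK j) = τ ∧ t₀.comp (iK j) = τ ∧ s₀ ≠ t₀ ∧
      Module.finrank ℚ ↥(adjoin ℚ (Set.range τ) ⊔ adjoin ℚ (Set.range s₀ ∪ Set.range t₀)) = 40)
    (hiso : ∀ j j' : J, j' ≠ j → nJ j = nJ j' → IsEmpty (KJ j' →+* KJ j))
    {N : ℕ} (κ : Fin N → Option ((j : J) × Fin (c j))) {X : AbelianVariety ℂ}
    (hX : Domination.AVDominatedBy X (⨁ fun l => ((κ l).elim E fun x => B x.1 x.2 : AbelianVariety ℂ))) : HodgeConjectureFor X.dim X.X :=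
  Domination.hodgeConjectureFor_of_avDominatedBy
    (hodgeConjectureFor_biproduct_sigma_free_of_shapes hW4 hM6 h2 iK nJ hdeg hB hE hΦ₀ hS hcnt hni hc3 hc4 hc5 hsep hmeet hodd h24 h40 hiso κ) hX

end Shapes

end Summit.HodgeConjecture.CorCM.MultiFieldWeil

end
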